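import Literature.NumberTheory.GaloisRepresentations.ExplicitAdjoinRootFieldProofs
import HarnessLib

/-!
# An explicit field `K(β) ⊆ K̄` from the finset of its roots

`Proofs` file (theorems only, no definitions, no named facts) in topic
`NumberTheory/GaloisRepresentations`, landed by the seat of bsd.S15
(`Literature.NumberTheory.EllipticCurves.conductorNorm_eq_artinConductorNat_of_isElliptic`): the
`Finset` form of `ExplicitAdjoinRootFieldProofs`, which is the shape a generated certificate file
uses (a literal finset `{r_1(β), …, r_n(β)}` whose cardinality is certified by pairwise
differences, rather than an injective function on `Fin n`):

* `rootSet_eq_coe_of_card_eq` — the root set of `g` is the given finset `R` (`#R = deg g`);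
* `normal_adjoin_simple_of_finset` — `K(β) = K(R)` is normal over `K`;
* `exists_algEquiv_apply_gen_eq_of_mem` — every `x ∈ R` is `τ(β)` for some `τ ∈ Aut(K(β)/K)`
  (`deg g = [K(β) : K]`);
* `coe_algEquiv_gen_mem` — conversely `τ(β) ∈ R` for every automorphism `τ`;
* `algEquiv_eq_of_apply_gen_eq` — an automorphism is determined by `τ(β)`.

## References

* S. Lang, *Algebra*, 3rd ed., Ch. V §3–§4. [folklore]

## Design

Theorems only, over any field `K`, inside `AlgebraicClosure K`.  Axioms: `propext`,
`Classical.choice`, `Quot.sound`.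
-/

noncomputable section

open scoped Classical Polynomial IntermediateField
open Polynomial IntermediateField

namespace Literature.NumberTheory.GaloisRepresentations

variable {K : Type*} [Field K]

local notation "Kbar" => AlgebraicClosure K

/-- **The root set of `g` is the given finset** when `#R = deg g` and `R` consists of roots.
[folklore] -/
theorem rootSet_eq_coe_of_card_eq {g : K[X]} (hg : g.Monic) (R : Finset Kbar)
    (hcard : R.card = g.natDegree) (hr : ∀ x ∈ R, aeval x g = 0) : g.rootSet Kbar = ↑R := by
  have hg0 : g ≠ 0 := hg.ne_zero
  symm
  apply Set.eq_of_subset_of_ncard_le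
  · intro x hx
    exact (mem_rootSet_of_ne hg0).mpr (hr x hx)
  · rw [Set.ncard_coe_finset, hcard, rootSet, Set.ncard_coe_finset]
    exact le_trans (Multiset.toFinset_card_le _) (le_trans (card_roots' _) natDegree_map_le)
  · exact g.rootSet_finite Kbar

/-- **`K(β) = K(R)` is normal over `K`** when `R ⊆ K(β)` is the finset of all roots of `g` and
`β ∈ R`. [folklore] -/
theorem normal_adjoin_simple_of_finset {β : Kbar} {g : K[X]} (hg : g.Monic) (R : Finset Kbar)
    (hcard : R.card = g.natDegree) (hr : ∀ x ∈ R, aeval x g = 0) (hRF : ∀ x ∈ R, x ∈ K⟮β⟯)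
    (hβ : β ∈ R) : Normal K K⟮β⟯ := by
  have hroot := rootSet_eq_coe_of_card_eq hg R hcard hr
  have heq : K⟮β⟯ = adjoin K (g.rootSet Kbar) := by
    rw [hroot]
    apply le_antisymm
    · exact adjoin_le_iff.mpr (by rintro _ rfl; exact subset_adjoin K _ (Finset.mem_coe.mpr hβ))
    · exact adjoin_le_iff.mpr fun x hx ↦ hRF x (Finset.mem_coe.mp hx)
  rw [heq]
  haveI := adjoin_rootSet_isSplittingField (K := K) (L := Kbar) (p := g)
    (IsAlgClosed.splits (g.map (algebraMap K Kbar)))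
  exact Normal.of_isSplittingField g

/-- **Every listed root is `τ(β)` for an automorphism `τ`** (`K(β)/K` normal, `deg g = [K(β) : K]`).
[folklore] -/
theorem exists_algEquiv_apply_gen_eq_of_mem {β : Kbar} [Normal K K⟮β⟯] {g : K[X]} (hg : g.Monic)
    (hdeg : g.natDegree = Module.finrank K K⟮β⟯) (hβ : aeval β g = 0) {x : Kbar}
    (hx : aeval x g = 0) (hxF : x ∈ K⟮β⟯) :
    ∃ τ : K⟮β⟯ ≃ₐ[K] K⟮β⟯, ((τ (AdjoinSimple.gen K β) : K⟮β⟯) : Kbar) = x := by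
  have hint : IsIntegral K β := Algebra.IsIntegral.isIntegral β
  have hmin : minpoly K β = g := minpoly_eq_of_natDegree_eq_finrank hg hβ hdeg
  have hirr : Irreducible g := hmin ▸ minpoly.irreducible hint
  have hconj : minpoly K (⟨x, hxF⟩ : K⟮β⟯) = minpoly K (AdjoinSimple.gen K β) := by
    rw [IntermediateField.minpoly_gen, hmin,
      ← minpoly.algebraMap_eq (algebraMap K⟮β⟯ Kbar).injective (⟨x, hxF⟩ : K⟮β⟯)]
    exact (minpoly.eq_of_irreducible_of_monic hirr hx hg).symm
  have hmem : (⟨x, hxF⟩ : K⟮β⟯) ∈ MulAction.orbit (K⟮β⟯ ≃ₐ[K] K⟮β⟯) (AdjoinSimple.gen K β) :=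
    (Normal.minpoly_eq_iff_mem_orbit (F := K) K⟮β⟯).mp hconj
  obtain ⟨τ, hτ⟩ := MulAction.mem_orbit_iff.mp hmem
  exact ⟨τ, by rw [show τ (AdjoinSimple.gen K β) = ⟨x, hxF⟩ from hτ]⟩

/-- **`τ(β)` is one of the listed roots** for every automorphism `τ`. [folklore] -/
theorem coe_algEquiv_gen_mem {β : Kbar} {g : K[X]} (hg : g.Monic) (hβ : aeval β g = 0)
    (R : Finset Kbar) (hcard : R.card = g.natDegree) (hr : ∀ x ∈ R, aeval x g = 0)
    (τ : K⟮β⟯ ≃ₐ[K] K⟮β⟯) : ((τ (AdjoinSimple.gen K β) : K⟮β⟯) : Kbar) ∈ R := by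
  have hroot := rootSet_eq_coe_of_card_eq hg R hcard hr
  rw [← Finset.mem_coe, ← hroot, mem_rootSet_of_ne hg.ne_zero]
  -- `g(τ β) = τ(g(β)) = 0`, read in `K̄`
  have h1 : ((τ (aeval (AdjoinSimple.gen K β) g) : K⟮β⟯) : Kbar) =
      aeval ((τ (AdjoinSimple.gen K β) : K⟮β⟯) : Kbar) g := coe_algEquiv_aeval_gen τ g
  rw [← h1]
  have h0 : (aeval (AdjoinSimple.gen K β) g : K⟮β⟯) = 0 := by
    apply (ZeroMemClass.coe_eq_zero).mp
    rw [AdjoinSimple.coe_aeval_gen_apply]; exact hβ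
  rw [h0, map_zero]
  rfl

/-- **An automorphism of `K(β)/K` is determined by its value on `β`.** [folklore] -/
theorem algEquiv_eq_of_apply_gen_eq {β : Kbar} {τ₁ τ₂ : K⟮β⟯ ≃ₐ[K] K⟮β⟯}
    (h : τ₁ (AdjoinSimple.gen K β) = τ₂ (AdjoinSimple.gen K β)) : τ₁ = τ₂ := by
  apply AlgEquiv.coe_toAlgHom_injective
  refine adjoin_algHom_ext K fun x hx ↦ ?_
  rw [Set.mem_singleton_iff] at hx
  subst hx
  exact h

end Literature.NumberTheory.GaloisRepresentations

end
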